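import Mathlib
import HarnessLib

/-!
# Crux `MuOrdinaryFamilyRT` (stmt-Langlands-13757), line `char-zero-dominance`: stub 4,
# accumulation of arithmetic points

This file proves STUB 4 (`stub_accumulation`: the abstract accumulation kernel, pure commutative
algebra + `3`-adic ultrametric bookkeeping; verbatim Stub C of the sister line
`weight-blind-lambda-adic-rt`) of the checked skeleton `Cruxes/MuOrdinaryFamilyRT/Lines/char-zero-dominance.lean`
for the crux `Summit.Langlands.Langlands.Theses.PicardMuOrdinary.MuOrdinaryFamilyRT`.  The statement
`S.stub_accumulation` below is VERBATIM the registered one (same namespace as the skeleton).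

**Proof.** Replace `R` by the domain `B = R ⧸ 𝔮`, finite and torsion-free over `Λ` (dominance),
with `Λ`-module generators `g₁, …, gₙ`.  For any ring map `φ : B → ℚ̄₃`, `φ(gᵢ)` is a root of the
image under `φ|_Λ` of the minimal polynomial `Fᵢ` of `gᵢ` (monic: `Λ` is normal), so `(x̄ gᵢ)ᵢ` lies
in a finite set `V` of root-tuples; an integer-weighted functional `ℓ(v) = Σ tⁱ vᵢ` separates `V`
(`exists_separating`), whence a uniform gap `3^{-N}` (`exists_gap`).  Put `b = Σ tⁱ gᵢ`.  For
`κ ∈ D` close enough to `x|_Λ`, ultrametric root continuity (`exists_root_near`) gives a root `β` of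
`κ(F_b)` within `3^{-N}` of `x̄ b`; `Λ[b] ≅ Λ[X]/(F_b)` (`minpoly.equivAdjoin`, normality), lying
over and `IsAlgClosed.lift` give `ȳ : B → ℚ̄₃` over `κ` with `ȳ b = β` (`exists_ringHom_extend`).
Root continuity again moves `(ȳ gᵢ)ᵢ` to some `r ∈ V` with `ℓ r` within `3^{-N}` of
`ℓ (x̄ gᵢ)ᵢ = x̄ b`; the gap forces `r = (x̄ gᵢ)ᵢ`, so `ȳ ≈ x̄` on the generators, hence on `B`
(all values are `3`-adic integers: `norm_root_le_one`).  References: Matsumura, *Commutative Ring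
Theory*, Thm 9.3 (lying over); B. H. Neumann's separating-element trick.
-/

-- `Summit.Langlands.Langlands.…` (summit = sub-problem name, D-0017 layout) trips `dupNamespace` on every decl.
set_option linter.dupNamespace false

namespace Summit.Langlands.Langlands.Cruxes.MuOrdinaryFamilyRT.CharZeroDominance

open Polynomial

/-- STUB 4 — **accumulation of arithmetic points** (pure commutative algebra + `3`-adic analysis,
provable now; size M/L).  VERBATIM weight-blind's Stub C (one proof serves both lines): `Λ` a
Noetherian integrally closed domain, `R` a finite `Λ`-algebra, `x : R → ℚ̄₃` integral on `Λ`, a prime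
`𝔮 ⊆ ker x` with `𝔮 ∩ Λ = 0` (here: `𝔮 = ⊥` of the integral family, dominating by
`algebraMap_injective_of_ringKrullDim_le`), `D` a set of `Λ`-points with values in the integers of one
finite `E/ℚ₃` accumulating at `x|_Λ` uniformly ⇒ points of `R` over `D` accumulate at `x` UNIFORMLY on
`R`.  Intended proof (Disproof cycle 1 checked it end to end): `B = R/𝔮` finite torsion-free over the
normal `Λ`; finite fibre over `κ = x|_Λ`; a separating element `b` (B.H. Neumann); `Λ[b] ≅ Λ[X]/(F_b)`
(normality); root continuity; lying over + `IsAlgClosed.lift`; compactness of bounded-degree points;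
ultrametric bookkeeping.  Dominance and normality are LOAD-BEARING (landed negatives p74393, p74844,
re-exported above). -/
def S.stub_accumulation : Prop :=
  ∀ (Λ R : Type) [CommRing Λ] [IsDomain Λ] [IsNoetherianRing Λ] [IsIntegrallyClosed Λ]
    [CommRing R] [Algebra Λ R] [Module.Finite Λ R]
    (x : R →+* PadicAlgCl 3) (D : Set (Λ →+* PadicAlgCl 3))
    (E : IntermediateField ℚ_[3] (PadicAlgCl 3)), FiniteDimensional ℚ_[3] E →
    (∃ 𝔮 : Ideal R, 𝔮.IsPrime ∧ Ideal.comap (algebraMap Λ R) 𝔮 = ⊥ ∧ ∀ r ∈ 𝔮, x r = 0) →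
    (∀ a : Λ, ‖x (algebraMap Λ R a)‖ ≤ 1) →
    (∀ κ ∈ D, ∀ a : Λ, κ a ∈ E ∧ ‖κ a‖ ≤ 1) →
    (∀ m : ℕ, ∃ κ ∈ D, ∀ a : Λ, ‖κ a - x (algebraMap Λ R a)‖ ≤ ((3 : ℝ)⁻¹) ^ m) →
    ∀ m : ℕ, ∃ y : R →+* PadicAlgCl 3, y.comp (algebraMap Λ R) ∈ D ∧
      ∀ r : R, ‖y r - x r‖ ≤ ((3 : ℝ)⁻¹) ^ m

/-! ## Ultrametric root lemmas -/

/-- **Root bound.**  In an ultrametric normed field, a root of a monic polynomial all of whose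
coefficients have norm `≤ 1` has norm `≤ 1`: otherwise the top term strictly dominates the rest. -/
theorem norm_root_le_one {K : Type*} [NormedField K] [IsUltrametricDist K] {P : K[X]}
    (hP : P.Monic) (hcoeff : ∀ i, ‖P.coeff i‖ ≤ 1) {α : K} (hroot : P.eval α = 0) : ‖α‖ ≤ 1 := by
  by_contra h
  push Not at h
  rcases Nat.eq_zero_or_pos P.natDegree with hd | hd
  · rw [hP.natDegree_eq_zero.mp hd, eval_one] at hroot
    exact one_ne_zero hroot
  have hsum := eval_eq_sum_range (p := P) α
  rw [Finset.sum_range_succ, hP.coeff_natDegree, one_mul, hroot] at hsum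
  have hle : ‖α‖ ^ P.natDegree ≤ ‖α‖ ^ (P.natDegree - 1) := by
    rw [← norm_pow, eq_neg_of_add_eq_zero_right hsum.symm, norm_neg]
    refine IsUltrametricDist.norm_sum_le_of_forall_le_of_nonneg (by positivity) fun i hi => ?_
    rw [norm_mul, norm_pow]
    exact (mul_le_mul (hcoeff i) (pow_le_pow_right₀ h.le
      (Nat.le_sub_one_of_lt (Finset.mem_range.mp hi))) (by positivity) zero_le_one).trans_eq
      (one_mul _)
  exact absurd (hle.trans_lt (pow_lt_pow_right₀ h (Nat.sub_one_lt_of_lt hd))) (lt_irrefl _)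

/-- If every `β` in a nonempty multiset `s` satisfies `η < ‖α - β‖` (with `0 ≤ η`), then
`η ^ card s < ‖∏_{β ∈ s} (α - β)‖`. -/
theorem pow_card_lt_norm_prod {K : Type*} [NormedField K] (α : K) {η : ℝ} (hη : 0 ≤ η) :
    ∀ s : Multiset K, s ≠ 0 → (∀ β ∈ s, η < ‖α - β‖) →
      η ^ Multiset.card s < ‖(s.map (fun β => α - β)).prod‖ := by
  intro s
  induction s using Multiset.induction_on with
  | empty => exact fun h => absurd rfl h
  | cons a t ih =>
    intro _ hlt
    have ha : η < ‖α - a‖ := hlt a (Multiset.mem_cons_self a t)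
    rw [Multiset.map_cons, Multiset.prod_cons, norm_mul, Multiset.card_cons, pow_succ']
    by_cases ht : t = 0
    · subst ht
      simpa using ha
    · exact mul_lt_mul'' ha (ih ht fun β hβ => hlt β (Multiset.mem_cons_of_mem hβ)) hη
        (pow_nonneg hη _)

/-- **Root continuity** (ultrametric, over an algebraically closed field).  Let `Q` be monic of
degree `e ≥ 1` and let `P` have coefficients within `η ^ e` of those of `Q`.  Then every root `α` of
`P` with `‖α‖ ≤ 1` is within `η` of a root of `Q`: indeed `‖Q(α)‖ = ‖(Q - P)(α)‖ ≤ η ^ e`, while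
`‖Q(α)‖ = ∏_{β} ‖α - β‖` over the `e` roots `β` of `Q`. -/
theorem exists_root_near {K : Type*} [NormedField K] [IsUltrametricDist K] [IsAlgClosed K]
    {P Q : K[X]} (hQ : Q.Monic) (he : 0 < Q.natDegree) {η : ℝ} (hη : 0 ≤ η)
    (hPQ : ∀ i, ‖P.coeff i - Q.coeff i‖ ≤ η ^ Q.natDegree) {α : K} (hα : ‖α‖ ≤ 1)
    (hroot : P.eval α = 0) : ∃ β ∈ Q.roots, ‖α - β‖ ≤ η := by
  by_contra hcon
  push Not at hcon
  -- upper bound from the coefficients: `‖Q(α)‖ = ‖(Q - P)(α)‖ ≤ η ^ e`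
  have h1 : ‖Q.eval α‖ ≤ η ^ Q.natDegree := by
    rw [show Q.eval α = (Q - P).eval α by rw [eval_sub, hroot, sub_zero], eval_eq_sum_range]
    refine IsUltrametricDist.norm_sum_le_of_forall_le_of_nonneg (pow_nonneg hη _) fun i _ => ?_
    rw [coeff_sub, norm_mul, norm_pow, norm_sub_rev]
    exact (mul_le_mul (hPQ i) (pow_le_one₀ (norm_nonneg _) hα) (by positivity)
      (pow_nonneg hη _)).trans_eq (mul_one _)
  -- lower bound from the roots: `‖Q(α)‖ = ∏ ‖α - β‖ > η ^ e`
  have hs := IsAlgClosed.splits Q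
  have h0 : Q.roots ≠ 0 := fun h0 => by
    rw [hs.natDegree_eq_card_roots, h0, Multiset.card_zero] at he
    exact lt_irrefl 0 he
  have h2 := pow_card_lt_norm_prod α hη Q.roots h0 hcon
  rw [← hs.natDegree_eq_card_roots, ← hs.eval_eq_prod_roots_of_monic hQ] at h2
  exact absurd (h2.trans_le h1) (lt_irrefl _)

/-! ## The separating integer functional and the gap -/

/-- **Separating functional.**  For a finite set `V` of `n`-tuples in a field of characteristic
zero there is a natural number `t` such that `v ↦ Σᵢ tⁱ vᵢ` is injective on `V`: for each pair
`v ≠ v'` the bad `t` are (the natural numbers among) the roots of the nonzero polynomial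
`Σᵢ (vᵢ - v'ᵢ) Xⁱ`, finitely many in all. -/
theorem exists_separating {K : Type*} [Field K] [CharZero K] {n : ℕ} (V : Finset (Fin n → K)) :
    ∃ t : ℕ, ∀ v ∈ V, ∀ v' ∈ V,
      (∑ i : Fin n, (t : K) ^ (i : ℕ) * v i) = (∑ i : Fin n, (t : K) ^ (i : ℕ) * v' i) →
        v = v' := by
  classical
  -- the polynomial `Σ wᵢ Xⁱ` attached to a tuple `w`: evaluation and non-vanishing
  let poly : (Fin n → K) → K[X] := fun w => ∑ i : Fin n, monomial (i : ℕ) (w i)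
  have hev : ∀ (w : Fin n → K) (s : K), (poly w).eval s = ∑ i : Fin n, s ^ (i : ℕ) * w i :=
    fun w s => by simp only [poly, eval_finsetSum, eval_monomial, mul_comm]
  have hne : ∀ w : Fin n → K, poly w = 0 → w = 0 := fun w hzero => by
    funext i
    have hc := congrArg (fun p : K[X] => p.coeff (i : ℕ)) hzero
    simp only [poly, finsetSum_coeff, coeff_monomial, coeff_zero, Fin.val_inj,
      Finset.sum_ite_eq', Finset.mem_univ, if_true] at hc
    exact hc
  -- avoid the finitely many bad parameters
  obtain ⟨t, ht⟩ := Infinite.exists_notMem_finset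
    (((V ×ˢ V).filter (fun p => p.1 ≠ p.2)).biUnion fun p =>
      (poly (p.1 - p.2)).roots.toFinset.preimage (Nat.cast : ℕ → K) Nat.cast_injective.injOn)
  refine ⟨t, fun v hv v' hv' heq => ?_⟩
  by_contra hvv
  apply ht
  simp only [Finset.mem_biUnion, Finset.mem_filter, Finset.mem_product, Finset.mem_preimage,
    Multiset.mem_toFinset]
  refine ⟨(v, v'), ⟨⟨hv, hv'⟩, hvv⟩, ?_⟩
  show (t : K) ∈ (poly (v - v')).roots
  rw [mem_roots (fun h => hvv (sub_eq_zero.mp (hne _ h))), IsRoot.def, hev]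
  simp only [Pi.sub_apply, mul_sub, Finset.sum_sub_distrib]
  exact sub_eq_zero.mpr heq

/-- **Uniform gap.**  If `ℓ` is injective on the finite set `V`, then for some `N ≥ m` any two
points of `V` whose `ℓ`-values are within `3^{-N}` coincide. -/
theorem exists_gap {ι E : Type*} [NormedAddCommGroup E] (V : Finset ι) (ℓ : ι → E)
    (hℓ : ∀ v ∈ V, ∀ v' ∈ V, ℓ v = ℓ v' → v = v') (m : ℕ) :
    ∃ N : ℕ, m ≤ N ∧ ∀ v ∈ V, ∀ v' ∈ V, ‖ℓ v - ℓ v'‖ ≤ ((3 : ℝ)⁻¹) ^ N → v = v' := by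
  classical
  have hmem : ∀ v ∈ V, ∀ v' ∈ V, v ≠ v' → (v, v') ∈ (V ×ˢ V).filter (fun p => p.1 ≠ p.2) :=
    fun v hv v' hv' hvv => Finset.mem_filter.mpr ⟨Finset.mem_product.mpr ⟨hv, hv'⟩, hvv⟩
  by_cases hne : ((V ×ˢ V).filter (fun p => p.1 ≠ p.2)).Nonempty
  · obtain ⟨p₀, hp₀, hmin⟩ :=
      ((V ×ˢ V).filter (fun p => p.1 ≠ p.2)).exists_min_image (fun p => ‖ℓ p.1 - ℓ p.2‖) hne
    obtain ⟨hp₀V, hp₀ne⟩ := Finset.mem_filter.mp hp₀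
    have hγ : 0 < ‖ℓ p₀.1 - ℓ p₀.2‖ := norm_sub_pos_iff.mpr fun h => hp₀ne
      (hℓ _ (Finset.mem_product.mp hp₀V).1 _ (Finset.mem_product.mp hp₀V).2 h)
    obtain ⟨N₀, hN₀⟩ := exists_pow_lt_of_lt_one hγ (by norm_num : (3 : ℝ)⁻¹ < 1)
    refine ⟨max m N₀, le_max_left _ _, fun v hv v' hv' hle => by_contra fun hvv => ?_⟩
    have h1 : ‖ℓ p₀.1 - ℓ p₀.2‖ ≤ ‖ℓ v - ℓ v'‖ := hmin _ (hmem v hv v' hv' hvv)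
    have h2 : ((3 : ℝ)⁻¹) ^ max m N₀ ≤ ((3 : ℝ)⁻¹) ^ N₀ :=
      pow_le_pow_of_le_one (by norm_num) (by norm_num) (le_max_right _ _)
    linarith
  · exact ⟨m, le_rfl, fun v hv v' hv' _ => by_contra fun hvv => hne ⟨_, hmem v hv v' hv' hvv⟩⟩

/-! ## Extending ring homomorphisms along integral extensions -/

/-- **Extension along an integral extension into an algebraically closed field.**  If `B` is
integral over `A` and `y₀ : A → F` kills the kernel of `A → B`, then `y₀` extends to `B`: take a
prime `𝔓` of `B` lying over `ker y₀` and apply `IsAlgClosed.lift` to the integral extension of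
domains `A ⧸ ker y₀ ↪ B ⧸ 𝔓`. -/
theorem exists_ringHom_comp_eq_of_isIntegral {A B F : Type*} [CommRing A] [CommRing B]
    [Algebra A B] [Algebra.IsIntegral A B] [Field F] [IsAlgClosed F] (y₀ : A →+* F)
    (hker : RingHom.ker (algebraMap A B) ≤ RingHom.ker y₀) :
    ∃ y : B →+* F, y.comp (algebraMap A B) = y₀ := by
  haveI : (RingHom.ker y₀).IsPrime := RingHom.ker_isPrime y₀
  -- a prime `𝔓` of `B` over `ker y₀`; below `p := 𝔓 ∩ A = ker y₀`
  obtain ⟨𝔓, _, h𝔓p, h𝔓⟩ := Ideal.exists_ideal_over_prime_of_isIntegral (RingHom.ker y₀)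
    (⊥ : Ideal B) (by rw [← RingHom.ker_eq_comap_bot]; exact hker)
  haveI := h𝔓p
  have hy₀p : ∀ a ∈ Ideal.comap (algebraMap A B) 𝔓, y₀ a = 0 := fun a ha => by
    rwa [h𝔓, RingHom.mem_ker] at ha
  -- `A ⧸ p ↪ F` and `A ⧸ p ↪ B ⧸ 𝔓` (an integral extension of domains): `IsAlgClosed.lift`
  letI : Algebra (A ⧸ Ideal.comap (algebraMap A B) 𝔓) F :=
    (Ideal.Quotient.lift (Ideal.comap (algebraMap A B) 𝔓) y₀ hy₀p).toAlgebra
  haveI : Module.IsTorsionFree (A ⧸ Ideal.comap (algebraMap A B) 𝔓) F :=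
    Module.isTorsionFree_iff_algebraMap_injective.mpr
      ((Ideal.injective_lift_iff hy₀p).mpr h𝔓.symm)
  haveI : Module.IsTorsionFree (A ⧸ Ideal.comap (algebraMap A B) 𝔓) (B ⧸ 𝔓) :=
    Module.isTorsionFree_iff_algebraMap_injective.mpr Ideal.algebraMap_quotient_injective
  let φ : (B ⧸ 𝔓) →ₐ[A ⧸ Ideal.comap (algebraMap A B) 𝔓] F := IsAlgClosed.lift
  refine ⟨φ.toRingHom.comp (Ideal.Quotient.mk 𝔓), RingHom.ext fun a => ?_⟩
  change φ (algebraMap (A ⧸ Ideal.comap (algebraMap A B) 𝔓) (B ⧸ 𝔓)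
    (Ideal.Quotient.mk _ a)) = y₀ a
  rw [φ.commutes]
  exact Ideal.Quotient.lift_mk _ y₀ hy₀p

/-- **Extension lemma (normality).**  For `Λ` an integrally closed domain, `B` an integral
torsion-free domain over `Λ`, `b ∈ B`, `κ : Λ → F` into an algebraically closed field and `β` a
root of the image under `κ` of the minimal polynomial of `b`, there is `y : B → F` over `κ` with
`y b = β`: `Λ[b] ≅ Λ[X]/(minpoly)` (`minpoly.equivAdjoin`) gives `y₀ : Λ[b] → F`, which extends. -/
theorem exists_ringHom_extend {Λ B F : Type*} [CommRing Λ] [IsDomain Λ] [IsIntegrallyClosed Λ]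
    [CommRing B] [IsDomain B] [Algebra Λ B] [Module.IsTorsionFree Λ B] [Algebra.IsIntegral Λ B]
    [Field F] [IsAlgClosed F] (b : B) (κ : Λ →+* F) (β : F)
    (hβ : (minpoly Λ b).eval₂ κ β = 0) :
    ∃ y : B →+* F, y.comp (algebraMap Λ B) = κ ∧ y b = β := by
  -- `y₀ : Λ[b] ≅ Λ[X]/(minpoly Λ b) → F`, `X ↦ β`
  let A₀ := Algebra.adjoin Λ ({b} : Set B)
  let e := minpoly.equivAdjoin (Algebra.IsIntegral.isIntegral (R := Λ) b)
  let y₀ : ↥A₀ →+* F :=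
    (AdjoinRoot.lift κ β hβ).comp (e.symm : ↥A₀ →+* AdjoinRoot (minpoly Λ b))
  -- extend `y₀` along the integral extension `Λ[b] ⊆ B`
  haveI : Algebra.IsIntegral ↥A₀ B := Algebra.IsIntegral.tower_top Λ
  obtain ⟨y, hy⟩ := exists_ringHom_comp_eq_of_isIntegral (B := B) y₀
    (by rw [(RingHom.injective_iff_ker_eq_bot _).mp (fun _ _ h => Subtype.ext h)]; exact bot_le)
  have hyA : ∀ z : ↥A₀, y z = y₀ z := fun z => RingHom.congr_fun hy z
  refine ⟨y, RingHom.ext fun a => ?_, ?_⟩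
  · change y ((algebraMap Λ ↥A₀ a : ↥A₀) : B) = κ a
    rw [hyA]
    change AdjoinRoot.lift κ β hβ (e.symm (algebraMap Λ ↥A₀ a)) = κ a
    rw [AlgEquiv.commutes, AdjoinRoot.algebraMap_eq, AdjoinRoot.lift_of]
  · have h2 : e.symm ⟨b, Algebra.self_mem_adjoin_singleton Λ b⟩ =
        AdjoinRoot.root (minpoly Λ b) := by
      rw [AlgEquiv.symm_apply_eq]
      ext
      simp [e]
    change y ((⟨b, Algebra.self_mem_adjoin_singleton Λ b⟩ : ↥A₀) : B) = β
    rw [hyA]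
    change AdjoinRoot.lift κ β hβ (e.symm ⟨b, Algebra.self_mem_adjoin_singleton Λ b⟩) = β
    rw [h2, AdjoinRoot.lift_root]

/-- The value `φ c` of a ring map `φ : B → F` is a root of the image under `φ|_Λ` of the minimal
polynomial of `c`. -/
theorem eval_map_minpoly {Λ B F : Type*} [CommRing Λ] [CommRing B] [Algebra Λ B] [CommRing F]
    (φ : B →+* F) (c : B) : ((minpoly Λ c).map (φ.comp (algebraMap Λ B))).eval (φ c) = 0 := by
  rw [eval_map, ← hom_eval₂, ← aeval_def, minpoly.aeval, map_zero]

/-! ## The accumulation kernel -/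

/-- **Accumulation kernel, domain case.**  `Λ` an integrally closed domain, `B` a domain, finite
and torsion-free over `Λ`, `x : B → ℚ̄₃` a point with `x|_Λ` integral, `D` a set of integral
`Λ`-points accumulating `3`-adically at `x|_Λ` uniformly on `Λ`.  Then for every `m` some
`y : B → ℚ̄₃` over a weight in `D` satisfies `‖y b − x b‖ ≤ 3⁻ᵐ` for all `b ∈ B`. -/
theorem accumulation_domain (Λ B : Type*) [CommRing Λ] [IsDomain Λ] [IsIntegrallyClosed Λ]
    [CommRing B] [IsDomain B] [Algebra Λ B] [Module.Finite Λ B] [Module.IsTorsionFree Λ B]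
    (x : B →+* PadicAlgCl 3) (D : Set (Λ →+* PadicAlgCl 3))
    (hx : ∀ a : Λ, ‖x (algebraMap Λ B a)‖ ≤ 1) (hD : ∀ κ ∈ D, ∀ a : Λ, ‖κ a‖ ≤ 1)
    (hacc : ∀ M : ℕ, ∃ κ ∈ D, ∀ a : Λ, ‖κ a - x (algebraMap Λ B a)‖ ≤ ((3 : ℝ)⁻¹) ^ M)
    (m : ℕ) :
    ∃ y : B →+* PadicAlgCl 3, y.comp (algebraMap Λ B) ∈ D ∧
      ∀ b : B, ‖y b - x b‖ ≤ ((3 : ℝ)⁻¹) ^ m := by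
  classical
  haveI : Algebra.IsIntegral Λ B := Algebra.IsIntegral.of_finite Λ B
  have q0 : (0 : ℝ) ≤ (3 : ℝ)⁻¹ := by norm_num
  have q1 : (3 : ℝ)⁻¹ ≤ 1 := by norm_num
  have hint : ∀ c : B, IsIntegral Λ c := fun c => Algebra.IsIntegral.isIntegral c
  -- Step 1: generators `g` of `B` over `Λ`; the root polynomials `P i` over the weight `x|_Λ`
  obtain ⟨n, g, hg⟩ := Module.Finite.exists_fin (R := Λ) (M := B)
  obtain ⟨P, hP⟩ : ∃ P : Fin n → (PadicAlgCl 3)[X],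
      ∀ i, P i = (minpoly Λ (g i)).map (x.comp (algebraMap Λ B)) := ⟨_, fun i => rfl⟩
  have hPmonic : ∀ i, (P i).Monic := fun i => by
    rw [hP i]; exact (minpoly.monic (hint (g i))).map _
  let V : Finset (Fin n → PadicAlgCl 3) := Fintype.piFinset fun i => (P i).roots.toFinset
  have hV : ∀ v : Fin n → PadicAlgCl 3, v ∈ V ↔ ∀ i, (P i).IsRoot (v i) := fun v =>
    Fintype.mem_piFinset.trans (forall_congr' fun i => by
      rw [Multiset.mem_toFinset, mem_roots (hPmonic i).ne_zero])
  -- Step 2: a separating functional `ℓ = Σ tⁱ (·)ᵢ` on `V` and the separating element `b`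
  obtain ⟨t, ht⟩ := exists_separating V
  obtain ⟨ℓ, hℓ⟩ : ∃ ℓ : (Fin n → PadicAlgCl 3) → PadicAlgCl 3,
      ∀ v, ℓ v = ∑ i : Fin n, (t : PadicAlgCl 3) ^ (i : ℕ) * v i := ⟨_, fun v => rfl⟩
  have hℓsub : ∀ (v v' : Fin n → PadicAlgCl 3) (C : ℝ), 0 ≤ C → (∀ i, ‖v i - v' i‖ ≤ C) →
      ‖ℓ v - ℓ v'‖ ≤ C := fun v v' C hC h => by
    rw [hℓ, hℓ, ← Finset.sum_sub_distrib]
    refine IsUltrametricDist.norm_sum_le_of_forall_le_of_nonneg hC fun i _ => ?_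
    rw [← mul_sub, norm_mul, norm_pow]
    exact (mul_le_mul (pow_le_one₀ (norm_nonneg _) (IsUltrametricDist.norm_natCast_le_one _ t))
      (h i) (norm_nonneg _) zero_le_one).trans_eq (one_mul C)
  let b : B := ∑ i : Fin n, (t : B) ^ (i : ℕ) * g i
  have hφb : ∀ φ : B →+* PadicAlgCl 3, φ b = ℓ fun i => φ (g i) := fun φ => by
    rw [hℓ]; simp only [b, map_sum, map_mul, map_pow, map_natCast]
  -- Step 3: the gap `3^{-N}` separating the `ℓ`-values on `V`; degrees; the level `N * dtot`
  obtain ⟨N, hmN, hgap⟩ := exists_gap V ℓ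
    (fun v hv v' hv' h => ht v hv v' hv' (by rw [← hℓ, ← hℓ]; exact h)) m
  have hd : 0 < (minpoly Λ b).natDegree := minpoly.natDegree_pos (hint b)
  obtain ⟨dtot, hbd, hdi⟩ : ∃ dtot : ℕ, (minpoly Λ b).natDegree ≤ dtot ∧
      ∀ i, (minpoly Λ (g i)).natDegree ≤ dtot :=
    ⟨(minpoly Λ b).natDegree + ∑ i, (minpoly Λ (g i)).natDegree, le_self_add, fun i =>
      le_add_left (Finset.single_le_sum (f := fun j => (minpoly Λ (g j)).natDegree)
        (fun j _ => Nat.zero_le _) (Finset.mem_univ i))⟩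
  have hNM : N ≤ N * dtot := Nat.le_mul_of_pos_right N (hd.trans_le hbd)
  have hpow : ∀ e, e ≤ dtot → ((3 : ℝ)⁻¹) ^ (N * dtot) ≤ (((3 : ℝ)⁻¹) ^ N) ^ e := fun e he => by
    rw [← pow_mul]
    exact pow_le_pow_of_le_one q0 q1 (Nat.mul_le_mul_left N he)
  -- Step 4: an arithmetic weight `κ` at level `N * dtot`; a root `β` of `κ(minpoly b)` near `x b`
  obtain ⟨κ, hκD, hκ⟩ := hacc (N * dtot)
  obtain ⟨β, hβroot, hβ⟩ := exists_root_near (P := (minpoly Λ b).map (x.comp (algebraMap Λ B)))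
    ((minpoly.monic (hint b)).map κ) (by rwa [(minpoly.monic (hint b)).natDegree_map])
    (pow_nonneg q0 N)
    (fun i => by
      rw [coeff_map, coeff_map, (minpoly.monic (hint b)).natDegree_map, norm_sub_rev,
        RingHom.comp_apply]
      exact (hκ _).trans (hpow _ hbd))
    (norm_root_le_one ((minpoly.monic (hint b)).map _)
      (fun i => by rw [coeff_map, RingHom.comp_apply]; exact hx _) (eval_map_minpoly x b))
    (eval_map_minpoly x b)
  -- Step 5: extend `κ`, `b ↦ β` to `y : B → ℚ̄₃` over `κ`
  obtain ⟨y, hyκ, hyb⟩ := exists_ringHom_extend b κ β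
    (by simpa [eval_map] using (mem_roots ((minpoly.monic (hint b)).map κ).ne_zero).mp hβroot)
  refine ⟨y, by rw [hyκ]; exact hκD, ?_⟩
  -- Step 6: `y` is `3^{-N}`-close to `x` on the generators (root continuity again, and the gap)
  have hyg1 : ∀ i, ‖y (g i)‖ ≤ 1 := fun i =>
    norm_root_le_one ((minpoly.monic (hint (g i))).map κ)
      (fun j => by rw [coeff_map]; exact hD κ hκD _)
      (by simpa [hyκ] using eval_map_minpoly (Λ := Λ) y (g i))
  have hnear : ∀ i, ∃ r ∈ (P i).roots, ‖y (g i) - r‖ ≤ ((3 : ℝ)⁻¹) ^ N := fun i => by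
    refine exists_root_near (P := (minpoly Λ (g i)).map κ) (hPmonic i)
      (by rw [hP i, (minpoly.monic (hint (g i))).natDegree_map]; exact minpoly.natDegree_pos (hint _))
      (pow_nonneg q0 N) (fun j => ?_) (hyg1 i)
      (by simpa [hyκ] using eval_map_minpoly (Λ := Λ) y (g i))
    rw [hP i, coeff_map, coeff_map, (minpoly.monic (hint (g i))).natDegree_map, RingHom.comp_apply]
    exact (hκ _).trans (hpow _ (hdi i))
  choose r hr hyr using hnear
  have hrx : r = fun i => x (g i) := by
    refine hgap r ((hV r).mpr fun i => (mem_roots (hPmonic i).ne_zero).mp (hr i)) _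
      ((hV _).mpr fun i => by rw [hP i]; exact eval_map_minpoly x (g i)) ?_
    have h2 : ‖ℓ (fun i => y (g i)) - ℓ (fun i => x (g i))‖ ≤ ((3 : ℝ)⁻¹) ^ N := by
      rw [← hφb y, ← hφb x, hyb, norm_sub_rev]; exact hβ
    rw [← sub_add_sub_cancel (ℓ r) (ℓ fun i => y (g i)) (ℓ fun i => x (g i))]
    exact (IsUltrametricDist.norm_add_le_max _ _).trans
      (max_le ((norm_sub_rev _ _).trans_le (hℓsub _ _ _ (pow_nonneg q0 N) hyr)) h2)
  subst hrx
  -- Step 7: all of `B`, by the ultrametric inequality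
  intro b'
  obtain ⟨c, rfl⟩ := (Submodule.mem_span_range_iff_exists_fun Λ).mp
    (show b' ∈ Submodule.span Λ (Set.range g) by rw [hg]; exact Submodule.mem_top)
  rw [map_sum, map_sum, ← Finset.sum_sub_distrib]
  refine IsUltrametricDist.norm_sum_le_of_forall_le_of_nonneg (pow_nonneg q0 m) fun i _ => ?_
  rw [Algebra.smul_def, map_mul, map_mul,
    show y (algebraMap Λ B (c i)) = κ (c i) from RingHom.congr_fun hyκ (c i),
    show κ (c i) * y (g i) - x (algebraMap Λ B (c i)) * x (g i) =
      (κ (c i) - x (algebraMap Λ B (c i))) * y (g i) +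
        x (algebraMap Λ B (c i)) * (y (g i) - x (g i)) by ring]
  refine (IsUltrametricDist.norm_add_le_max _ _).trans (max_le ?_ ?_) <;> rw [norm_mul]
  · exact (mul_le_mul (hκ _) (hyg1 i) (norm_nonneg _) (pow_nonneg q0 _)).trans
      ((mul_one _).trans_le (pow_le_pow_of_le_one q0 q1 (hmN.trans hNM)))
  · exact (mul_le_mul (hx _) (hyr i) (norm_nonneg _) zero_le_one).trans
      ((one_mul _).trans_le (pow_le_pow_of_le_one q0 q1 hmN))

/-- **STUB 4 of the line `char-zero-dominance` (`stub_accumulation`, registered signature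
verbatim): accumulation of arithmetic points.**  Reduce to the domain `B = R ⧸ 𝔮`: it is finite
over `Λ`, and torsion-free because `𝔮 ∩ Λ = 0` (dominance); `x` factors through `B` since
`𝔮 ⊆ ker x`; a point of `B` over `κ ∈ D` close to `x̄` on `B` (`accumulation_domain`) pulls back
to a point of `R` over `κ` close to `x` on `R`.  The hypothesis on `E` is not needed. -/
theorem stub_accumulation : S.stub_accumulation := by
  intro Λ R _ _ _ _ _ _ _ x D E _ h𝔮 hx hD hacc m
  obtain ⟨𝔮, h𝔮p, h𝔮c, h𝔮x⟩ := h𝔮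
  haveI := h𝔮p
  -- dominance: `Λ → R ⧸ 𝔮` is injective, so the domain `R ⧸ 𝔮` is torsion-free over `Λ`
  haveI : Module.IsTorsionFree Λ (R ⧸ 𝔮) := by
    rw [Module.isTorsionFree_iff_algebraMap_injective, RingHom.injective_iff_ker_eq_bot,
      ← Ideal.Quotient.mk_comp_algebraMap, ← RingHom.comap_ker, Ideal.mk_ker, h𝔮c]
  -- `x` factors through `x̄ : R ⧸ 𝔮 → ℚ̄₃`; apply the domain case to `x̄` and pull back to `R`
  have hxq : ∀ r, Ideal.Quotient.lift 𝔮 x h𝔮x (Ideal.Quotient.mk 𝔮 r) = x r :=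
    fun r => Ideal.Quotient.lift_mk 𝔮 x h𝔮x
  have hxqa : ∀ a : Λ, Ideal.Quotient.lift 𝔮 x h𝔮x (algebraMap Λ (R ⧸ 𝔮) a) =
      x (algebraMap Λ R a) := fun a => hxq _
  obtain ⟨y, hyD, hy⟩ := accumulation_domain Λ (R ⧸ 𝔮) (Ideal.Quotient.lift 𝔮 x h𝔮x) D
    (fun a => by rw [hxqa]; exact hx a) (fun κ hκ a => (hD κ hκ a).2)
    (fun M => by
      obtain ⟨κ, hκD, hκ⟩ := hacc M
      exact ⟨κ, hκD, fun a => by rw [hxqa]; exact hκ a⟩) m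
  refine ⟨y.comp (Ideal.Quotient.mk 𝔮), ?_, fun r => ?_⟩
  · rw [RingHom.comp_assoc, Ideal.Quotient.mk_comp_algebraMap]; exact hyD
  · rw [RingHom.comp_apply, ← hxq r]; exact hy _

end Summit.Langlands.Langlands.Cruxes.MuOrdinaryFamilyRT.CharZeroDominance
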